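import Summits.ResolutionOfSingularities.ResolutionOfSingularities.Theorems.FrobeniusClosingPatchingRelPerfectDepthOneDictionaryStepPow
import HarnessLib

/-!
# Crux `PatchingRelPerfect` (stmt-ResolutionOfSingularities-16161), chain w52 — the POWER RUNG «R-pow»,
# part 1: the POWER FORMAT `K = H^k ⊔ 𝓘_E^k` and its dictionary step

[OURS · L1 W5.2 · rung tool] res-D-pv-054 AS res-L1-w52-stub-6, OFFER 05:50:34Z. Fact-free; nothing here is a
statement of the manuscript under review.

THE POWER FORMAT. On the X-side of the depth dictionary (`S` regular local, `g : X → Spec S` a blowing up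
cosupported in the closed point, `i : E ⟶ X` the regular exceptional carrier with `𝓘_E = i.ker` an effective
Cartier divisor) suppose the residual ideal has the shape

  `I𝒪_X = M · (H^k ⊔ 𝓘_E^k)`, `M` invertible, `H` ANY ideal sheaf, `k ≥ 1`,

with E-side datum `𝔠 := H|_E` (so `(H^k ⊔ 𝓘_E^k)|_E = 𝔠^k`: the idealistic exponent `(𝔠^k, k)`, equivalent to
`(𝔠, 1)`). Then ONE WEIGHT-ONE controlled step of `𝔠` on the threefold — `τ : E' → E` the blowing up of a regular
centre `C ⊇ 𝔠`, `𝔠𝒪_{E'} = C𝒪_{E'} · 𝔠'` (r-d1's `IsControlledSeq` step) — is matched by the weight-`k` dictionary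
step of res-D-pv-016's `DepthOne.dictionaryStep_pow` (p497259): the centre `Ĉ = C.map i` is weight-`k` PERMISSIBLE
because `H ≤ Ĉ` (`le_map_iff_comap_le`) gives `H^k ⊔ 𝓘_E^k ≤ Ĉ^k` — the obstruction `f₀ + t·f₁ ∉ Ĉ²` of a general
depth-two member does not arise for powers —, and the new residual ideal is again in power format:
`σᶜ(H^k ⊔ 𝓘_E^k, k) = H'^k ⊔ 𝓘_{E'}^k` with `H' = σᶜ(H, 1)` and `H'|_{E'} = 𝔠'` (cancel `𝓘_exc^k`, resp. `C𝒪_{E'}`).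

* `DepthPow.comap_powerFormat` — `(H^k ⊔ i.ker^k)|_E = (H|_E)^k`;
* `DepthPow.powerStep` — the dictionary step in power format (all fields of the X-side invariant re-established).

## References

* E. Bierstone, D. Grigoriev, P. Milman, J. Włodarczyk (2011), §3.2 Lemma 3.2.1. [BierstoneGrigorievMilmanWlodarczyk2011]
* U. Görtz, T. Wedhorn, *Algebraic Geometry I* (2020), Prop. 13.91 (1), 13.96 (2). [GortzWedhorn2020]
* J. Kollár, *Lectures on Resolution of Singularities* (2007), (3.111) Step 3. [Kollar2007]
* H. Hironaka, *Idealistic exponents of singularity* (1977), §1 (equivalence `(J^k, k b) ~ (J, b)`). [Hironaka1977]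
-/

-- `Summit.<Summit>.<Sub>.Theorems` with `Sub = Summit` (single-conjunct summit, D-0017)
set_option linter.dupNamespace false

noncomputable section

open CategoryTheory CategoryTheory.Limits AlgebraicGeometry TopologicalSpace
open Literature.AlgebraicGeometry.Resolution
open IsLocalRing

namespace Summit.ResolutionOfSingularities.ResolutionOfSingularities.Theorems

universe u

namespace DepthPow

/-- `⊥ ^ k = ⊥` for `k ≥ 1` in the semiring of ideal sheaves. [folklore] -/
theorem bot_pow {X : Scheme.{u}} {k : ℕ} (hk : 1 ≤ k) : (⊥ : X.IdealSheafData) ^ k = ⊥ := by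
  change (0 : X.IdealSheafData) ^ k = 0
  exact zero_pow (by omega)

/-- Powers are monotone in the semiring of ideal sheaves. [folklore] -/
theorem pow_mono {X : Scheme.{u}} {A B : X.IdealSheafData} (h : A ≤ B) (k : ℕ) : A ^ k ≤ B ^ k := by
  induction k with
  | zero => simp
  | succ k ih =>
      rw [pow_succ, pow_succ]
      exact mul_le_mul' ih h

/-- **The E-side datum of the power format**: `(H^k ⊔ 𝓘_E^k)|_E = (H|_E)^k` for a closed immersion
`i : E ⟶ X` (`𝓘_E|_E = 0`). [folklore] -/
theorem comap_powerFormat {E X : Scheme.{u}} (i : E ⟶ X) (H : X.IdealSheafData) {k : ℕ} (hk : 1 ≤ k) :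
    (H ^ k ⊔ i.ker ^ k).comap i = H.comap i ^ k := by
  rw [Scheme.IdealSheafData.comap_sup, comap_pow, comap_pow, comap_ker_self, bot_pow hk, sup_bot_eq]

/-- **The power-format dictionary step.** `S` regular local, `I ⊆ S`; `i : E ⟶ X` a closed immersion of the
regular `E` into the Noetherian regular `X` with `𝓘_E = i.ker` an effective Cartier divisor, `E` over the closed
point, `g : X → Spec S` a blowing up cosupported in the closed point, and the POWER FORMAT
`I𝒪_X = M · (H^k ⊔ 𝓘_E^k)`, `M` an effective Cartier ideal, `k ≥ 1`. One weight-one controlled step of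
`𝔠 = H|_E` — `τ : E' → E` blowing up a centre `C ⊇ 𝔠` with `V(C)` regular, `𝔠𝒪_{E'} = C𝒪_{E'} · 𝔠'` — is matched
by a blowing up `X' → X` re-establishing every field, with the new residual ideal again in power format
`H'^k ⊔ 𝓘_{E'}^k`, `H'|_{E'} = 𝔠'`. [cite: BierstoneGrigorievMilmanWlodarczyk2011, §3.2 Lemma 3.2.1]
[cite: GortzWedhorn2020, Prop. 13.91 (1), Prop. 13.96 (2)] [cite: Kollar2007, (3.111) Step 3] -/
theorem powerStep {S : Type u} [CommRing S] [IsRegularLocalRing S] (I : Ideal S) {k : ℕ} (hk : 1 ≤ k)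
    {E X : Scheme.{u}} (i : E ⟶ X) (g : X ⟶ Spec (.of S))
    [IsNoetherian X] (hX : Scheme.IsRegular X) (hE : Scheme.IsRegular E)
    [IsClosedImmersion i] (hiE : IsEffectiveCartier i.ker)
    (hEpt : ∀ e : E, g.base (i.base e) = IsLocalRing.closedPoint S)
    (hg : ∃ K₀ : (Spec (.of S)).IdealSheafData, IsBlowup g K₀ ∧
      (K₀.support : Set (Spec (.of S))) ⊆ {IsLocalRing.closedPoint S})
    (M H : X.IdealSheafData) (hM : IsEffectiveCartier M)
    (hfmt : (affineBlowup.idealSheaf I).comap g = M * (H ^ k ⊔ i.ker ^ k))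
    {E' : Scheme.{u}} (τ : E' ⟶ E) (C : E.IdealSheafData) (𝔠' : E'.IdealSheafData)
    (hC : Scheme.IsRegular C.subscheme) (hle : H.comap i ≤ C) (hτ : IsBlowup τ C)
    (hctrl : (H.comap i).comap τ = C.comap τ * 𝔠') :
    ∃ (X' : Scheme.{u}) (i' : E' ⟶ X') (g' : X' ⟶ Spec (.of S)) (M' H' : X'.IdealSheafData),
      IsNoetherian X' ∧ Scheme.IsRegular X' ∧ Scheme.IsRegular E' ∧ IsClosedImmersion i' ∧
      IsEffectiveCartier i'.ker ∧
      (∀ e : E', g'.base (i'.base e) = IsLocalRing.closedPoint S) ∧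
      (∃ K₀ : (Spec (.of S)).IdealSheafData, IsBlowup g' K₀ ∧
        (K₀.support : Set (Spec (.of S))) ⊆ {IsLocalRing.closedPoint S}) ∧
      IsEffectiveCartier M' ∧ H'.comap i' = 𝔠' ∧
      (affineBlowup.idealSheaf I).comap g' = M' * (H' ^ k ⊔ i'.ker ^ k) := by
  -- the centre pushed into `X` and the power-format residual ideal
  set Ch : X.IdealSheafData := C.map i with hCh
  set K : X.IdealSheafData := H ^ k ⊔ i.ker ^ k with hK
  have hHC : H ≤ Ch := by
    rw [hCh, Scheme.IdealSheafData.le_map_iff_comap_le]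
    exact hle
  have hkerC : i.ker ≤ Ch := DepthOne.ker_le_map_centre i C
  have hChE : Ch.comap i = C := DepthOne.comap_map_centre i C
  -- weight-`k` permissibility of `Ĉ` for the power format
  have hKC : K ≤ Ch ^ k := sup_le (pow_mono hHC k) (pow_mono hkerC k)
  -- the E-side: `K|_E = 𝔠^k` transforms with weight `k` to `𝔠'^k`
  have h𝔟 : K.comap i = H.comap i ^ k := comap_powerFormat i H hk
  have hctrl' : (K.comap i).comap τ = C.comap τ ^ k * 𝔠' ^ k := by
    rw [h𝔟, comap_pow, hctrl, mul_pow]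
  -- res-D-pv-016's dictionary step with exponent `k`
  obtain ⟨X', σ, hσ, hτ', hN, hX', hE', hi', hkerE', hkerfac, hpt, hg', hM', -, -, hfmt'⟩ :=
    DepthOne.dictionaryStep_pow I k i g (K.comap i) hX hE hiE hEpt hg M K hM le_sup_right rfl hfmt
      τ C (𝔠' ^ k) hC hKC hτ hctrl'
  set i' : E' ⟶ X' := hσ.strictTransformHom hτ' with hi'def
  haveI : IsClosedImmersion i' := hi'
  haveI : IsNoetherian X' := hN
  have hsq : i' ≫ σ = τ ≫ i := hσ.strictTransformHom_comp hτ'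
  -- the new `H`: the weight-one controlled transform
  set H' : X'.IdealSheafData := controlledTransform σ Ch H 1 with hH'
  have hHH' : Ch.comap σ * H' = H.comap σ := hσ.comap_mul_controlledTransform_one hHC
  -- the new residual ideal is again in power format
  have hexc : IsEffectiveCartier (Ch.comap σ) := hσ.isEffectiveCartier
  have hKK' : Ch.comap σ ^ k * controlledTransform σ Ch K k = K.comap σ :=
    hσ.pow_mul_controlledTransform_eq (by
      rw [← comap_pow]; exact Scheme.IdealSheafData.comap_mono (f := σ) hKC)
  have hK' : controlledTransform σ Ch K k = H' ^ k ⊔ i'.ker ^ k := by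
    apply (hexc.pow k).eq_of_mul_eq_mul
    rw [hKK', hK, Scheme.IdealSheafData.comap_sup, comap_pow, comap_pow, ← hHH', ← hkerfac, mul_pow, mul_pow]
    exact (mul_add _ _ _).symm
  refine ⟨X', i', σ ≫ g, M.comap σ * Ch.comap σ ^ k, H', hN, hX', hE', hi', hkerE', hpt, hg', hM', ?_, ?_⟩
  · -- `H'|_{E'} = 𝔠'`: cancel the effective Cartier divisor `C𝒪_{E'}`
    apply hτ.isEffectiveCartier.eq_of_mul_eq_mul
    have h1 : (Ch.comap σ).comap i' = C.comap τ := by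
      rw [← Scheme.IdealSheafData.comap_comp, hsq, Scheme.IdealSheafData.comap_comp, hChE]
    have h2 : (H.comap σ).comap i' = (H.comap i).comap τ := by
      rw [← Scheme.IdealSheafData.comap_comp, hsq, Scheme.IdealSheafData.comap_comp]
    rw [← hctrl, ← h2, ← hHH', comap_mul, h1]
  · rw [hfmt', hK']

end DepthPow

end Summit.ResolutionOfSingularities.ResolutionOfSingularities.Theorems

end
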